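import Literature.NumberTheory.Automorphic.ResGLnTraceFormEmbeddings
import Literature.NumberTheory.Automorphic.GLnAlgebraicDifferential
import Literature.NumberTheory.Automorphic.ResGLnKugaCasimirScalarW
import Literature.NumberTheory.Automorphic.ResGLnKugaCuspidal
import Literature.NumberTheory.Automorphic.ResGLnCoeffModuleAdmissibleForm
import HarnessLib

/-!
# The trace-form Casimir operator acts by a scalar on the coefficient module `E_λ`; basic
# non-trivial cuspidal cocycles are coclosed

Topic `NumberTheory/Automorphic`; namespace `Literature.NumberTheory.Automorphic.ConeDictionary`
(vocabulary of `ResGLnKugaHarmonic`).  Definitions with bodies (auxiliary operators, definitional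
re-typings) and theorems; no named fact, no `sorry`.

The hypothesis `hc'` of the Step-2 assembly of Borel's injectivity of cuspidal cohomology
(`ResGLnKugaHarmonic.d_eq_zero_and_coclosed_of_casimir_scalar`): the Casimir operator
`C_E = ∑_t dE_λ(b_t) dE_λ(b^t)` of the real trace form of `𝔤 = 𝔤𝔩ₙ(K_∞)` acts on
`E_λ = ⨂_τ V_{λ_τ}(ℂ)` by a SCALAR:

* `slotLie τ`, `slotDiff τ` (`P ↦ 1 ⊗ ⋯ ⊗ A_{λ_τ}(P) ⊗ ⋯ ⊗ 1`), `factorLieD`, `σT` — the Leibniz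
  differential of `E_λ` over the datum, slot by slot (`σT_apply`: `dE_λ(X) = ∑_τ slotDiff τ (τ̃ X)`,
  from `AlgDiff.factorLie_eq_algDiff`);
* **`op_σT_eq`** — `C_E = ∑_τ 1 ⊗ ⋯ ⊗ C^alg_{λ_τ} ⊗ ⋯ ⊗ 1`: the cross terms `τ ≠ τ'` vanish and
  the diagonal terms are the algebraic Casimirs, by the pushed canonical tensor
  `ResGLnTraceFormEmbeddings.sum_bilin_map_bD_dD` (orthogonality of the embeddings for the trace
  form);
* **`exists_op_σ𝔤S_eq_smul`** — hence `C_E = (∑_τ c_τ) · 1` (`AlgDiff.exists_casAlgD_eq_smul`,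
  Schur on each Weyl module);
* **`coclosed_of_cuspidal`** — STEPS 0 + 2 OF BOREL'S PROOF WITH ALL K-SIDE INPUTS DISCHARGED: for a
  clean cuspidal `π` of `GL_n(𝔸_K)` (`n ≠ 0`), every basic cocycle of positive degree of
  `C^•(𝔤, K_∞; W ⊗ E_λ)` which is not a coboundary is closed and coclosed
  (`d_eq_zero_and_coclosed_of_cuspidal` + `exists_op_lieRepW_eq_smul` + `exists_op_σ𝔤S_eq_smul`).

[cite: BorelWallach2000, I §2.3, II §2.5, Prop. 3.1]

## References

* A. Borel, N. Wallach (2000), I §2.3, II §2.5, 3.1 (held). [BorelWallach2000]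
* A. W. Knapp, *Lie Groups Beyond an Introduction* (2002), §V.4. [Knapp2002]
-/

noncomputable section

namespace Literature.NumberTheory.Automorphic

-- Mathlib idiom (as in `GKModules`): commutator bracket on matrix algebras and `Module.End`
attribute [local instance 100] LieRing.ofAssociativeRing

-- `Classical`: the place subtypes indexing `mixedSpace K` are `Fintype` classically (as in `AdelicGLnGlue`).
open scoped TensorProduct Classical _root_.Matrix
open _root_.NumberField _root_.NumberField.InfinitePlace _root_.NumberField.mixedEmbedding Finset RealMatrixGroup
open Literature.Algebra.Lie.ChevalleyEilenberg

namespace ConeDictionary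

section Coeff

variable (n : ℕ) (K : Type) [Field K] [NumberField K] (hcpt : isCompact_glFiniteIntegralLevel n K)
  (lam : (K →+* ℂ) → Fin n → ℤ)

/-- The honest tensor product underlying `E_λ = ResGLnCohomology.CoeffModule ℂ n K λ`. [folklore] -/
abbrev Tens : Type := ⨂[ℂ] τ : (K →+* ℂ), GLnCohomology.CoeffModule ℂ n (lam τ)

/-- **The slot embedding `u ↦ 1 ⊗ ⋯ ⊗ u ⊗ ⋯ ⊗ 1` as a morphism of real Lie algebras.** [folklore] -/
def slotLie (τ : K →+* ℂ) : Module.End ℂ (GLnCohomology.CoeffModule ℂ n (lam τ)) →ₗ⁅ℝ⁆ Module.End ℂ (Tens n K lam) :=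
  { toFun := fun u => PiTensor.slot (E := fun τ => GLnCohomology.CoeffModule ℂ n (lam τ)) τ u
    map_add' := fun u v => PiTensor.slot_add (E := fun τ => GLnCohomology.CoeffModule ℂ n (lam τ)) τ u v
    map_smul' := fun t u => by
      change PiTensor.slot (E := fun τ => GLnCohomology.CoeffModule ℂ n (lam τ)) τ ((t : ℂ) • u) =
        (t : ℂ) • PiTensor.slot (E := fun τ => GLnCohomology.CoeffModule ℂ n (lam τ)) τ u
      exact PiTensor.slot_smul (E := fun τ => GLnCohomology.CoeffModule ℂ n (lam τ)) τ (t : ℂ) u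
    map_lie' := fun {u v} => by
      change PiTensor.slot (E := fun τ => GLnCohomology.CoeffModule ℂ n (lam τ)) τ ⁅u, v⁆ =
        ⁅PiTensor.slot (E := fun τ => GLnCohomology.CoeffModule ℂ n (lam τ)) τ u,
          PiTensor.slot (E := fun τ => GLnCohomology.CoeffModule ℂ n (lam τ)) τ v⁆
      rw [Ring.lie_def, Ring.lie_def, PiTensor.slot_sub, PiTensor.slot_mul_same, PiTensor.slot_mul_same] }

omit [NumberField K] in
/-- Unfolding. [folklore] -/
@[simp] theorem slotLie_apply (τ : K →+* ℂ) (u : Module.End ℂ (GLnCohomology.CoeffModule ℂ n (lam τ))) :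
    slotLie n K lam τ u = PiTensor.slot (E := fun τ => GLnCohomology.CoeffModule ℂ n (lam τ)) τ u := rfl

/-- **`P ↦ 1 ⊗ ⋯ ⊗ A_{λ_τ}(P) ⊗ ⋯ ⊗ 1`**, the algebraic differential of the factor `τ` in its slot.
[cite: BorelWallach2000, 0 §2.3] -/
def slotDiff (τ : K →+* ℂ) : Matrix (Fin n) (Fin n) ℂ →ₗ⁅ℝ⁆ Module.End ℂ (Tens n K lam) :=
  (slotLie n K lam τ).comp (AlgDiff.algDiff n (lam τ))

omit [NumberField K] in
/-- Unfolding. [folklore] -/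
theorem slotDiff_apply (τ : K →+* ℂ) (P : Matrix (Fin n) (Fin n) ℂ) :
    slotDiff n K lam τ P = PiTensor.slot (E := fun τ => GLnCohomology.CoeffModule ℂ n (lam τ)) τ (AlgDiff.algDiff n (lam τ) P) :=
  rfl

omit [NumberField K] in
/-- `slotDiff` is complex-homogeneous. [folklore] -/
theorem slotDiff_smul (τ : K →+* ℂ) (c : ℂ) (P : Matrix (Fin n) (Fin n) ℂ) :
    slotDiff n K lam τ (c • P) = c • slotDiff n K lam τ P := by
  rw [slotDiff_apply, slotDiff_apply, AlgDiff.algDiff_smul, PiTensor.slot_smul]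

set_option maxHeartbeats 800000 in
-- one-time re-typing over the datum (definitional)
/-- The factor differential `dV_{λ_τ} ∘ τ̃`, over the datum. [folklore] -/
def factorLieD (τ : K →+* ℂ) : 𝔤D n K hcpt →ₗ⁅ℝ⁆ Module.End ℂ (GLnCohomology.CoeffModule ℂ n (lam τ)) :=
  ParallelWeight.factorLie K n (lam τ) τ

set_option maxHeartbeats 800000 in
-- as above
/-- `factorLieD τ X = A_{λ_τ}(τ̃ X)`. [cite: BorelWallach2000, 0 §2.3] -/
theorem factorLieD_eq_algDiff (τ : K →+* ℂ) (X : 𝔤D n K hcpt) :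
    factorLieD n K hcpt lam τ X =
      AlgDiff.algDiff n (lam τ) ((X : Matrix (Fin n) (Fin n) (mixedSpace K)).map (embeddingExt τ)) :=
  AlgDiff.factorLie_eq_algDiff n (lam τ) τ X

/-- **The Leibniz differential of `E_λ` on the honest tensor product, over the datum.**
[cite: BorelWallach2000, 0 §2.3] -/
def σT : 𝔤D n K hcpt →ₗ⁅ℝ⁆ Module.End ℂ (Tens n K lam) :=
  PiTensor.piLie (AutomorphyDatum.gl n K hcpt).arch fun τ => factorLieD n K hcpt lam τ

/-- `σT X = ∑_τ slotDiff τ (τ̃ X)`. [folklore] -/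
theorem σT_apply (X : 𝔤D n K hcpt) :
    σT n K hcpt lam X = ∑ τ, slotDiff n K lam τ ((X : Matrix (Fin n) (Fin n) (mixedSpace K)).map (embeddingExt τ)) := by
  rw [σT, PiTensor.piLie_apply]
  refine Finset.sum_congr rfl fun τ _ => ?_
  rw [slotDiff_apply, factorLieD_eq_algDiff]

set_option maxHeartbeats 800000 in
-- `σ𝔤S` is `σT` read on `E_λ`: both are the Leibniz sum of the factor differentials
/-- The trace-form Casimir operator of `E_λ` is that of `σT` (re-typing through
`AdmissibleForm.archCoeffLie_eq_sum`). [folklore] -/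
theorem op_σ𝔤S_apply (e : ResGLnCohomology.CoeffModule ℂ n K lam) :
    GKCasimir.op (AutomorphyDatum.gl n K hcpt).arch (σ𝔤S hcpt lam) (bD n K hcpt) (dD n K hcpt) e =
      @id (ResGLnCohomology.CoeffModule ℂ n K lam)
        (GKCasimir.op (AutomorphyDatum.gl n K hcpt).arch (σT n K hcpt lam) (bD n K hcpt) (dD n K hcpt)
          (e : Tens n K lam)) := by
  have hσ : ∀ X : 𝔤D n K hcpt, (σ𝔤S hcpt lam X : ResGLnCohomology.CoeffModule ℂ n K lam →ₗ[ℂ] _) =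
      (σT n K hcpt lam X : Tens n K lam →ₗ[ℂ] Tens n K lam) := fun X => by
    rw [σT, PiTensor.piLie_apply]
    exact AdmissibleForm.archCoeffLie_eq_sum n K lam X
  rw [GKCasimir.op_apply, id, GKCasimir.op_apply]
  refine Finset.sum_congr rfl fun t _ => ?_
  rw [hσ, hσ]
  rfl

/-- **`C_E = ∑_τ 1 ⊗ ⋯ ⊗ C^alg_{λ_τ} ⊗ ⋯ ⊗ 1`**: in the trace-form Casimir operator of `E_λ` the
cross terms between different embeddings vanish and the diagonal terms are the algebraic Casimir
operators of the factors (orthogonality of the embeddings for the trace form,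
`sum_bilin_map_bD_dD`). [cite: BorelWallach2000, I §2.3] -/
theorem op_σT_eq :
    GKCasimir.op (AutomorphyDatum.gl n K hcpt).arch (σT n K hcpt lam) (bD n K hcpt) (dD n K hcpt) =
      ∑ τ, PiTensor.slot (E := fun τ => GLnCohomology.CoeffModule ℂ n (lam τ)) τ (AlgDiff.casAlgD n (lam τ)) := by
  rw [GKCasimir.op]
  simp only [σT_apply, Finset.sum_mul_sum]
  rw [Finset.sum_comm]
  refine Finset.sum_congr rfl fun τ _ => ?_
  rw [Finset.sum_comm]
  have hΨ := fun τ' => sum_bilin_map_bD_dD n K hcpt (GLnComplexCasimir.prodBilin (slotDiff n K lam τ) (slotDiff n K lam τ'))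
    (fun c X Y => by rw [GLnComplexCasimir.prodBilin_apply, GLnComplexCasimir.prodBilin_apply, slotDiff_smul, smul_mul_assoc])
    (fun c X Y => by rw [GLnComplexCasimir.prodBilin_apply, GLnComplexCasimir.prodBilin_apply, slotDiff_smul, mul_smul_comm])
    τ τ'
  simp only [GLnComplexCasimir.prodBilin_apply] at hΨ
  simp only [hΨ, Finset.sum_ite_eq, Finset.mem_univ, if_true]
  rw [AlgDiff.casAlgD, ComplexPlace.slot_sum']
  refine Finset.sum_congr rfl fun a _ => ?_
  rw [ComplexPlace.slot_sum']
  refine Finset.sum_congr rfl fun b _ => ?_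
  rw [slotDiff_apply, slotDiff_apply, PiTensor.slot_mul_same]

/-- **The trace-form Casimir operator acts on `E_λ` by a scalar** (`∑_τ c_τ`, `c_τ` the Casimir
scalar of `V_{λ_τ}(ℂ)`).  This is the hypothesis `hc'` of `d_eq_zero_and_coclosed_of_casimir_scalar`.
[cite: BorelWallach2000, I §2.3, II §2.5] -/
theorem exists_op_σ𝔤S_eq_smul :
    ∃ c' : ℂ, ∀ e : ResGLnCohomology.CoeffModule ℂ n K lam,
      GKCasimir.op (AutomorphyDatum.gl n K hcpt).arch (σ𝔤S hcpt lam) (bD n K hcpt) (dD n K hcpt) e = c' • e := by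
  choose c hc using fun τ : K →+* ℂ => AlgDiff.exists_casAlgD_eq_smul n (lam τ)
  refine ⟨∑ τ, c τ, fun e => ?_⟩
  rw [op_σ𝔤S_apply, op_σT_eq]
  simp only [hc, PiTensor.slot_smul, ComplexPlace.slot_one']
  rw [LinearMap.sum_apply, Finset.sum_smul]
  rfl

end Coeff

/-! ### Steps 0 + 2 of Borel's proof, all K-side inputs discharged -/

variable {n : ℕ} {K : Type} [Field K] [NumberField K] {hcpt : isCompact_glFiniteIntegralLevel n K}
  (π : CuspidalAutomorphicRepData n K hcpt)
  (S : Finset {w : InfinitePlace K // w.IsReal}) (lam : (K →+* ℂ) → Fin n → ℤ)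

/-- **Basic non-trivial cuspidal cocycles are closed and coclosed** (Steps 0 + 2 of Borel's
injectivity proof, `ResGLnCuspidalCohomologyApex`, for a clean cuspidal `π` of `GL_n(𝔸_K)`,
`n ≠ 0`): for every basic cocycle `η ∈ Z^{q+1}` of `C^•(𝔤, K_∞; W ⊗ E_λ)` (`i_Z η = 0`) which is
not a coboundary, `dη = 0` and `h η = 0` for the homotopy of `s = π ⊗ 1 - 1 ⊗ dE_λ` along the
orthonormal basis `x` of `𝔭₀` — Kuga's lemma with the Petersson form, the Casimir scalars of `W`
(`exists_op_lieRepW_eq_smul`) and of `E_λ` (`exists_op_σ𝔤S_eq_smul`), and Wigner's lemma.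
[cite: BorelWallach2000, II §2.5, Prop. 3.1; I §5.3] -/
theorem coclosed_of_cuspidal [NeZero n] (hW' : π.1.W' = ⊥) (q : ℕ) {η : Cochain π.1 lam (q + 1)}
    (hZ : η ∈ (gkComplexLS π.1 S lam).cocycles (q + 1)) (hB : η ∉ (gkComplexLS π.1 S lam).coboundaries (q + 1))
    (hins : ins q (⟨1, trivial⟩ : (AutomorphyDatum.gl n K hcpt).arch.lie) η = 0) :
    d ℝ (𝔤D n K hcpt) (Carrier π.1 lam) (q + 1) η = 0 ∧
      casimirHomotopy (kugaS π.1 lam) (xD n K hcpt) (xD n K hcpt) q η = 0 := by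
  obtain ⟨c, hc⟩ := exists_op_lieRepW_eq_smul π.1 hW'
  obtain ⟨c', hc'⟩ := exists_op_σ𝔤S_eq_smul n K hcpt lam
  exact d_eq_zero_and_coclosed_of_cuspidal π S lam hW' hc hc' q hZ hB hins

end ConeDictionary

end Literature.NumberTheory.Automorphic

end
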